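import Summits.BirchSwinnertonDyer.Rank1Residual.Additive.RamifiedSevenGenusNormedFamilyFields
import Literature.NumberTheory.ComplexMultiplication.EllipticUnits.KroneckerLimitFormulaGenusCharacters
import HarnessLib

set_option autoImplicit false

/-!
# `𝒞₇` genus road (crux `EllipticUnitValueSevenOfGZK`, K7r), the (5)-unit programme (SUMMON GENUS-UNIT-A5), File B2a:
# TRANSPORT ALONG THE PIN'S IDENTIFICATION `e : K̄ → ℚ̄` — `e` is surjective, automorphisms of `K(𝔪ₙ)/K` extend to
# `Gal(ℚ̄/ℚ)`, the complex conjugation of a complex embedding of `ℚ̄`, and the index-2 dichotomy at `e(K) = ℚ(e√−7)`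
# (memo S4/S5 «ℚ̄-side bookkeeping»; THEOREMS ONLY)

Cell bsd-cm, seat bsd-cm-k-ty1 g26 (literature-prover); ruled typing memo `pub/bsd-cm/bsd-cm-k-ty1/g26/G45-typing-memo.md`
(c225f82434dc25c5, pen D941/D948: File B split B1/B2/B3).  The value pin `IsNormedEllipticUnitFamily F θu` carries an
identification `e : AlgebraicClosure K →+* AlgebraicClosure ℚ` of UNRELATED types; every comparison between the Kato side
(`Gal(K(7^{n+1}𝔣)/K)`, `ι̂ : K̄ → ℂ`) and the genus side (`Gal(F′ₙ/ℚ)`, units of `F′ₙ ⊂ ℚ̄`) goes through it.  This file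
provides the transport lemmas, all GENERAL (any number field `K`, any such `e`), none a definition:

* §1 `surjective_algClosureHom` — `e` is SURJECTIVE (ℚ̄ is integral over the algebraically closed field `e(K̄)`; Mathlib's
  `IsAlgClosed.ringHom_bijective_of_isIntegral`); `exists_complexEmbedding_extends` — a complex embedding `Φ : ℚ̄ → ℂ` with
  `Φ ∘ e = ι̂` (the memo's `φ₀ = ι̂ ∘ e⁻¹`, now on all of `ℚ̄`).
* §2 `exists_absGal_extends` — every `τ ∈ Gal(E/K)` (`E/K` normal inside `K̄`) is `e`-conjugate to some `σ ∈ Gal(ℚ̄/ℚ)`: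
  `σ (e y) = e (τ y)` on `E`; conversely `exists_gal_of_forall_apply_eq` — every `σ ∈ Gal(ℚ̄/ℚ)` fixing `e(K)` pointwise is
  `e`-conjugate on `E` to some `τ ∈ Gal(E/K)`.  Readings carried along: `apply_eq_pow_of_extends` (`τ ζ = ζ^a ⇒ σ (e ζ) = (e ζ)^a`).
* §3 `exists_complexConjugation` — for every embedding `Φ : ℚ̄ → ℂ` an automorphism `c ∈ Gal(ℚ̄/ℚ)` with `Φ ∘ c = conj ∘ Φ`
  (`AlgHom.restrictNormal'`; the pattern of `Pohlmann1968…exists_algEquiv_comp_eq`); `complexConjugation_apply_of_pow_eq_one`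
  (`c ζ = ζ⁻¹` on roots of unity); `complexConjugation_apply_sqrt` (`c (e s) = −e s` for `s² = −7`, via `Φ (e s) = ι s ∉ ℝ`).
* §4 THE INDEX-2 DICHOTOMY at `e(K)`: `forall_apply_eq_iff_apply_sqrt_eq` (an automorphism fixes `e(K)` pointwise iff it fixes
  `e s`, `K = ℚ(s)`), `apply_sqrt_eq_or_eq_neg`, and `fixes_or_conj_mul_fixes` (`σ` fixes `e(K)` or `c σ` does).

HONEST LABEL: general Galois bookkeeping; no definition, no named fact, no instance; nothing closes; stmt-BirchSwinnertonDyer-19945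
OPEN; K1ᵘ NOT proved; `X12.CMRamifiedSeven` NOT proved; BSD is claimed for no curve; no summit statement is proved by this seat.

## References
* K. Kato, Astérisque 295 (2004) §15.14 (p. 264, «K ⊂ ℚ(ζ_N)», the comparison of the two towers) [Kato2004Asterisque].
* G. Shimura, *Abelian Varieties with Complex Multiplication and Modular Functions* (1998) §8.1 (embeddings of a normal field
  differ by automorphisms; complex conjugation) [Shimura1998].
* J. Neukirch, *Algebraic Number Theory* (1999) Ch. IV §1–§2 (infinite Galois theory, extension of automorphisms) [NeukirchANT1999].
* Tree: B1 `RamifiedSevenGenusKatoSideLevelIdentity.lean` (p787265), `RamifiedSevenGenusNormedFamilyFields.lean` (p782488: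
  `preimageField`, `apply_algebraMap_mem_layer`), `ThetaSingularValues.lean` (`algClosureEmb`).
-/

noncomputable section

open scoped NumberField ComplexConjugate
open IsDedekindDomain NumberField
open Literature.NumberTheory.ComplexMultiplication.EllipticUnits

namespace Summit.BirchSwinnertonDyer.Rank1Residual.Additive.GenusSeven

variable {K : Type} [Field K] [NumberField K]

/-! ## §1 `e : K̄ → ℚ̄` is surjective; the complex embedding `Φ = ι̂ ∘ e⁻¹` of `ℚ̄` -/

section Surjective

/-- Transport of `Algebra.IsAlgebraic` along an equality of algebra structures (the elaborator's `ℚ`-algebra structure on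
`ℚ̄` versus `AlgebraicClosure.instAlgebra ℚ`; they are equal by `Subsingleton (Algebra ℚ _)`). [folklore] -/
private theorem isAlgebraic_of_algebra_eq {F L : Type*} [Field F] [Field L] {A : Algebra F L} (B : Algebra F L)
    (h : A = B) (hA : @Algebra.IsAlgebraic F L _ _ A) : @Algebra.IsAlgebraic F L _ _ B := by
  subst h; exact hA

/-- `ℚ̄ = AlgebraicClosure ℚ` is an algebraic closure of `ℚ` for the `ℚ`-algebra structure the elaborator picks (hence
`Normal ℚ ℚ̄`, `Algebra.IsAlgebraic ℚ ℚ̄` by `haveI`). [cite: NeukirchANT1999, Ch. IV §1] -/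
theorem isAlgClosure_rat_algebraicClosure : IsAlgClosure ℚ (AlgebraicClosure ℚ) :=
  ⟨inferInstance, isAlgebraic_of_algebra_eq _ (Subsingleton.elim _ _) (AlgebraicClosure.isAlgebraic ℚ)⟩

/-- **`e : K̄ → ℚ̄` is surjective**: `ℚ̄` is integral over `ℚ`, hence over the algebraically closed field `e(K̄)`.
[cite: NeukirchANT1999, Ch. IV §1 (algebraic closures)] -/
theorem surjective_algClosureHom (e : AlgebraicClosure K →+* AlgebraicClosure ℚ) : Function.Surjective e := by
  haveI : Algebra.IsAlgebraic ℚ (AlgebraicClosure ℚ) := isAlgClosure_rat_algebraicClosure.isAlgebraic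
  refine (IsAlgClosed.ringHom_bijective_of_isIntegral e fun x => ?_).2
  obtain ⟨p, hpm, hpx⟩ := (Algebra.IsAlgebraic.isAlgebraic (R := ℚ) x).isIntegral
  refine ⟨(p.map (algebraMap ℚ K)).map (algebraMap K (AlgebraicClosure K)), (hpm.map _).map _, ?_⟩
  have hcomp : (e.comp (algebraMap K (AlgebraicClosure K))).comp (algebraMap ℚ K) = algebraMap ℚ (AlgebraicClosure ℚ) :=
    Subsingleton.elim _ _
  rw [Polynomial.eval₂_map, Polynomial.eval₂_map, hcomp]
  exact hpx

/-- `e` is bijective. [cite: NeukirchANT1999, Ch. IV §1] -/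
theorem bijective_algClosureHom (e : AlgebraicClosure K →+* AlgebraicClosure ℚ) : Function.Bijective e :=
  ⟨e.injective, surjective_algClosureHom e⟩

/-- **The complex embedding `Φ = ι̂ ∘ e⁻¹` of `ℚ̄`**: for `ι : K → ℂ` there is `Φ : ℚ̄ → ℂ` with `Φ (e y) = ι̂ y` for all
`y ∈ K̄` (`ι̂ = algClosureEmb ι`); in particular `Φ (e k) = ι k` on `K`. [cite: Kato2004Asterisque, §15.14 (p. 264)] -/
theorem exists_complexEmbedding_extends (e : AlgebraicClosure K →+* AlgebraicClosure ℚ) (ι : K →+* ℂ) :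
    ∃ Φ : AlgebraicClosure ℚ →+* ℂ, ∀ y : AlgebraicClosure K, Φ (e y) = algClosureEmb ι y := by
  let ê : AlgebraicClosure K ≃+* AlgebraicClosure ℚ := RingEquiv.ofBijective e (bijective_algClosureHom e)
  refine ⟨(algClosureEmb ι).comp ê.symm.toRingHom, fun y => ?_⟩
  change algClosureEmb ι (ê.symm (ê y)) = _
  rw [ê.symm_apply_apply]

end Surjective

/-! ## §2 Automorphisms of `E/K` (inside `K̄`) versus automorphisms of `ℚ̄/ℚ`, along `e` -/

section Extend

/-- **Every `τ ∈ Gal(E/K)` is `e`-conjugate to an automorphism of `ℚ̄`**: lift `τ` to `K̄` (`E/K` inside the normal `K̄/K`)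
and conjugate by the bijection `e`. [cite: NeukirchANT1999, Ch. IV §1 (extension of isomorphisms to algebraic closures)] -/
theorem exists_absGal_extends (e : AlgebraicClosure K →+* AlgebraicClosure ℚ) (E : IntermediateField K (AlgebraicClosure K))
    (τ : E ≃ₐ[K] E) :
    ∃ σ : AlgebraicClosure ℚ ≃ₐ[ℚ] AlgebraicClosure ℚ, ∀ y : E, σ (e (y : AlgebraicClosure K)) = e (τ y : AlgebraicClosure K) := by
  let ê : AlgebraicClosure K ≃+* AlgebraicClosure ℚ := RingEquiv.ofBijective e (bijective_algClosureHom e)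
  let τ' : AlgebraicClosure K ≃ₐ[K] AlgebraicClosure K := τ.liftNormal (AlgebraicClosure K)
  let r : AlgebraicClosure ℚ ≃+* AlgebraicClosure ℚ := ê.symm.trans (τ'.toRingEquiv.trans ê)
  refine ⟨AlgEquiv.ofRingEquiv (f := r) (fun q => ?_), fun y => ?_⟩
  · rw [Algebra.algebraMap_eq_smul_one, map_rat_smul, map_one]
  · change ê (τ' (ê.symm (ê (y : AlgebraicClosure K)))) = _
    rw [ê.symm_apply_apply]
    change e (τ' (algebraMap E (AlgebraicClosure K) y)) = _
    rw [AlgEquiv.liftNormal_commutes]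
    rfl

/-- **Conversely**: an automorphism `σ` of `ℚ̄` fixing `e(K)` pointwise is `e`-conjugate on a NORMAL `E/K` to some
`τ ∈ Gal(E/K)`. [cite: NeukirchANT1999, Ch. IV §1] -/
theorem exists_gal_of_forall_apply_eq (e : AlgebraicClosure K →+* AlgebraicClosure ℚ)
    (E : IntermediateField K (AlgebraicClosure K)) [Normal K E] (σ : AlgebraicClosure ℚ ≃ₐ[ℚ] AlgebraicClosure ℚ)
    (hσ : ∀ k : K, σ (e (algebraMap K (AlgebraicClosure K) k)) = e (algebraMap K (AlgebraicClosure K) k)) :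
    ∃ τ : E ≃ₐ[K] E, ∀ y : E, σ (e (y : AlgebraicClosure K)) = e (τ y : AlgebraicClosure K) := by
  let ê : AlgebraicClosure K ≃+* AlgebraicClosure ℚ := RingEquiv.ofBijective e (bijective_algClosureHom e)
  let r : AlgebraicClosure K ≃+* AlgebraicClosure K := ê.trans (σ.toRingEquiv.trans ê.symm)
  have hr : ∀ k : K, r (algebraMap K (AlgebraicClosure K) k) = algebraMap K (AlgebraicClosure K) k := fun k => by
    change ê.symm (σ (e _)) = _
    rw [hσ k]
    exact ê.symm_apply_apply _
  let ρ : AlgebraicClosure K ≃ₐ[K] AlgebraicClosure K := AlgEquiv.ofRingEquiv (f := r) hr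
  refine ⟨ρ.restrictNormal E, fun y => ?_⟩
  have h := AlgEquiv.restrictNormal_commutes ρ E y
  rw [IntermediateField.algebraMap_apply, IntermediateField.algebraMap_apply] at h
  rw [h]
  change _ = ê (ê.symm (σ (e _)))
  rw [ê.apply_symm_apply]

omit [NumberField K] in
/-- **Readings are carried along `e`**: if `σ` is `e`-conjugate to `τ` on `E` and `τ ζ = ζ^a` for `ζ ∈ E`, then
`σ (e ζ) = (e ζ)^a`. [cite: Kato2004Asterisque, §15.14 (p. 264)] -/
theorem apply_eq_pow_of_extends {e : AlgebraicClosure K →+* AlgebraicClosure ℚ} {E : IntermediateField K (AlgebraicClosure K)}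
    {τ : E ≃ₐ[K] E} {σ : AlgebraicClosure ℚ ≃ₐ[ℚ] AlgebraicClosure ℚ}
    (hσ : ∀ y : E, σ (e (y : AlgebraicClosure K)) = e (τ y : AlgebraicClosure K)) {ζ : E} {a : ℕ} (ha : τ ζ = ζ ^ a) :
    σ (e (ζ : AlgebraicClosure K)) = e (ζ : AlgebraicClosure K) ^ a := by
  rw [hσ ζ, ha, SubmonoidClass.coe_pow, map_pow]

omit [NumberField K] in
/-- An `e`-conjugate `σ` of a `K`-automorphism fixes `e(K)` pointwise. [cite: Kato2004Asterisque, §15.14 (p. 264)] -/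
theorem apply_algebraMap_eq_of_extends {e : AlgebraicClosure K →+* AlgebraicClosure ℚ}
    {E : IntermediateField K (AlgebraicClosure K)} {τ : E ≃ₐ[K] E} {σ : AlgebraicClosure ℚ ≃ₐ[ℚ] AlgebraicClosure ℚ}
    (hσ : ∀ y : E, σ (e (y : AlgebraicClosure K)) = e (τ y : AlgebraicClosure K)) (k : K) :
    σ (e (algebraMap K (AlgebraicClosure K) k)) = e (algebraMap K (AlgebraicClosure K) k) := by
  have h := hσ (algebraMap K E k)
  rw [AlgEquiv.commutes] at h
  exact h

end Extend

/-! ## §3 Complex conjugation on `ℚ̄` with respect to an embedding `Φ : ℚ̄ → ℂ` -/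

section Conj

/-- **Complex conjugation**: for every embedding `Φ : ℚ̄ → ℂ` there is `c ∈ Gal(ℚ̄/ℚ)` with `Φ (c x) = conj (Φ x)` —
the two embeddings `Φ`, `conj ∘ Φ` of the normal extension `ℚ̄/ℚ` differ by an automorphism (`AlgHom.restrictNormal'`).
[cite: Shimura1998, §8.1 (complex conjugation on a normal field)] -/
theorem exists_complexConjugation (Φ : AlgebraicClosure ℚ →+* ℂ) :
    ∃ c : AlgebraicClosure ℚ ≃ₐ[ℚ] AlgebraicClosure ℚ, ∀ x : AlgebraicClosure ℚ, Φ (c x) = conj (Φ x) := by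
  haveI : IsAlgClosure ℚ (AlgebraicClosure ℚ) := isAlgClosure_rat_algebraicClosure
  haveI : Normal ℚ (AlgebraicClosure ℚ) := IsAlgClosure.normal ℚ _
  letI : Algebra (AlgebraicClosure ℚ) ℂ := Φ.toAlgebra
  haveI : IsScalarTower ℚ (AlgebraicClosure ℚ) ℂ := IsScalarTower.of_algebraMap_eq fun q => (map_ratCast Φ q).symm
  refine ⟨(((starRingEnd ℂ).comp Φ).toRatAlgHom).restrictNormal' (AlgebraicClosure ℚ), fun x => ?_⟩
  have h := (((starRingEnd ℂ).comp Φ).toRatAlgHom).restrictNormal_commutes (AlgebraicClosure ℚ) x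
  rw [Algebra.algebraMap_self, RingHom.id_apply, RingHom.toRatAlgHom_apply] at h
  exact h

/-- **`c ζ = ζ⁻¹` on roots of unity** (`|Φ ζ| = 1`, so `conj (Φ ζ) = (Φ ζ)⁻¹`). [cite: Shimura1998, §8.1] -/
theorem complexConjugation_apply_of_pow_eq_one {Φ : AlgebraicClosure ℚ →+* ℂ} {c : AlgebraicClosure ℚ ≃ₐ[ℚ] AlgebraicClosure ℚ}
    (hc : ∀ x : AlgebraicClosure ℚ, Φ (c x) = conj (Φ x)) {ζ : AlgebraicClosure ℚ} {m : ℕ} (hm : m ≠ 0) (hζ : ζ ^ m = 1) :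
    c ζ = ζ⁻¹ := by
  apply Φ.injective
  have hζ0 : ζ ≠ 0 := fun h => by rw [h, zero_pow hm] at hζ; exact zero_ne_one hζ
  have hnorm : ‖Φ ζ‖ = 1 := by
    have h1 : ‖Φ ζ‖ ^ m = 1 := by rw [← norm_pow, ← map_pow, hζ, map_one, norm_one]
    exact (pow_eq_one_iff_of_nonneg (norm_nonneg _) hm).mp h1
  rw [hc, map_inv₀, Complex.inv_def, Complex.normSq_eq_norm_sq, hnorm, one_pow, inv_one, Complex.ofReal_one, mul_one]

/-- `conj (ι s) = −ι s ≠ ι s` for `s² = −7`: `ι(s)` is purely imaginary and non-zero. [cite: Shimura1998, §8.1] -/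
theorem conj_apply_sqrt_eq_neg (ι : K →+* ℂ) {s : K} (hs : s ^ 2 = -7) : conj (ι s) = -ι s := by
  have h2 : (ι s) ^ 2 = -7 := by rw [← map_pow, hs, map_neg, map_ofNat]
  have hre : (ι s).re = 0 := by
    have him2 : ((ι s) ^ 2).im = 0 := by rw [h2]; simp
    have hre2 : ((ι s) ^ 2).re = -7 := by rw [h2]; simp
    rw [sq, Complex.mul_im] at him2
    rw [sq, Complex.mul_re] at hre2
    have h0 : (ι s).re * (ι s).im = 0 := by linarith
    rcases mul_eq_zero.mp h0 with h | h
    · exact h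
    · rw [h, mul_zero, sub_zero] at hre2
      nlinarith [mul_self_nonneg (ι s).re]
  apply Complex.ext
  · simp [hre]
  · simp

/-- **`c (e s) = −(e s)`** for the pin's `s² = −7` when `Φ ∘ e = ι̂` (`Φ (c (e s)) = conj (ι s) = −ι s = Φ (−e s)`).
[cite: Shimura1998, §8.1] -/
theorem complexConjugation_apply_sqrt {e : AlgebraicClosure K →+* AlgebraicClosure ℚ} {ι : K →+* ℂ}
    {Φ : AlgebraicClosure ℚ →+* ℂ} (hΦ : ∀ y : AlgebraicClosure K, Φ (e y) = algClosureEmb ι y)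
    {c : AlgebraicClosure ℚ ≃ₐ[ℚ] AlgebraicClosure ℚ} (hc : ∀ x : AlgebraicClosure ℚ, Φ (c x) = conj (Φ x))
    {s : K} (hs : s ^ 2 = -7) :
    c (e (algebraMap K (AlgebraicClosure K) s)) = -e (algebraMap K (AlgebraicClosure K) s) := by
  apply Φ.injective
  rw [hc, hΦ, algClosureEmb_algebraMap, conj_apply_sqrt_eq_neg ι hs, map_neg, hΦ, algClosureEmb_algebraMap]

end Conj

/-! ## §4 The index-2 dichotomy at `e(K) = ℚ(e s)` -/

section IndexTwo

/-- **An automorphism of `ℚ̄` fixes `e(K)` pointwise iff it fixes `e(s)`** (`K = ℚ(s)` for `[K : ℚ] = 2`, `s ∉ ℚ`).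
[cite: NeukirchANT1999, Ch. IV §1] -/
theorem forall_apply_algebraMap_eq_iff (hK2 : Module.finrank ℚ K = 2) {s : K} (hs : s ^ 2 = -7)
    (e : AlgebraicClosure K →+* AlgebraicClosure ℚ) (σ : AlgebraicClosure ℚ ≃ₐ[ℚ] AlgebraicClosure ℚ) :
    (∀ k : K, σ (e (algebraMap K (AlgebraicClosure K) k)) = e (algebraMap K (AlgebraicClosure K) k)) ↔
      σ (e (algebraMap K (AlgebraicClosure K) s)) = e (algebraMap K (AlgebraicClosure K) s) := by
  refine ⟨fun h => h s, fun h k => ?_⟩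
  -- the `ℚ`-subalgebra of `K` fixed (after `e`) by `σ` contains `s`, hence is everything
  let ψ : K →ₐ[ℚ] AlgebraicClosure ℚ := (e.comp (algebraMap K (AlgebraicClosure K))).toRatAlgHom
  let S : IntermediateField ℚ K :=
    { carrier := {k : K | σ (ψ k) = ψ k}
      mul_mem' := fun {a b} ha hb => by
        simp only [Set.mem_setOf_eq, map_mul] at ha hb ⊢; rw [ha, hb]
      one_mem' := by simp
      add_mem' := fun {a b} ha hb => by
        simp only [Set.mem_setOf_eq, map_add] at ha hb ⊢; rw [ha, hb]
      zero_mem' := by simp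
      algebraMap_mem' := fun q => by
        simp only [Set.mem_setOf_eq, AlgHom.commutes, AlgEquiv.commutes]
      inv_mem' := fun a ha => by
        simp only [Set.mem_setOf_eq, map_inv₀] at ha ⊢; rw [ha] }
  have hψ : ∀ x : K, ψ x = e (algebraMap K (AlgebraicClosure K) x) := fun x => rfl
  have hsS : s ∈ S := by change σ (ψ s) = ψ s; rw [hψ]; exact h
  have hint : IsIntegral ℚ s := Algebra.IsIntegral.isIntegral s
  have hnot : s ∉ (algebraMap ℚ K).range := by
    rintro ⟨q, hq⟩
    have h1 : (algebraMap ℚ K) (q ^ 2) = (algebraMap ℚ K) (-7) := by rw [map_pow, hq, hs]; simp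
    have h2 : q ^ 2 = -7 := (algebraMap ℚ K).injective h1
    nlinarith [sq_nonneg q]
  have h2le : 2 ≤ (minpoly ℚ s).natDegree := (minpoly.two_le_natDegree_iff hint).mpr hnot
  have htop : IntermediateField.adjoin ℚ {s} = (⊤ : IntermediateField ℚ K) :=
    IntermediateField.eq_of_le_of_finrank_eq le_top
      (by rw [IntermediateField.adjoin.finrank hint, IntermediateField.finrank_top', hK2]
          exact le_antisymm (hK2 ▸ minpoly.natDegree_le s) h2le)
  have hSle : IntermediateField.adjoin ℚ {s} ≤ S := IntermediateField.adjoin_le_iff.mpr (Set.singleton_subset_iff.mpr hsS)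
  have hk : k ∈ S := hSle (htop ▸ IntermediateField.mem_top)
  exact hk

/-- `σ (e s) = ± e s` for every automorphism `σ` of `ℚ̄` (`(σ (e s))² = −7`). [cite: NeukirchANT1999, Ch. IV §1] -/
theorem apply_sqrt_eq_or_eq_neg {s : K} (hs : s ^ 2 = -7) (e : AlgebraicClosure K →+* AlgebraicClosure ℚ)
    (σ : AlgebraicClosure ℚ ≃ₐ[ℚ] AlgebraicClosure ℚ) :
    σ (e (algebraMap K (AlgebraicClosure K) s)) = e (algebraMap K (AlgebraicClosure K) s) ∨
      σ (e (algebraMap K (AlgebraicClosure K) s)) = -e (algebraMap K (AlgebraicClosure K) s) := by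
  apply sq_eq_sq_iff_eq_or_eq_neg.mp
  have h7 : (e (algebraMap K (AlgebraicClosure K) s)) ^ 2 = -7 := by
    rw [← map_pow, ← map_pow, hs, map_neg, map_ofNat, map_neg, map_ofNat]
  rw [← map_pow, h7, map_neg, map_ofNat]

/-- **THE INDEX-2 DICHOTOMY**: with `c` a complex conjugation (`c (e s) = −e s`), every automorphism `σ` of `ℚ̄` either
fixes `e(K)` pointwise or `c ∘ σ` does (`Gal(F′ₙ/ℚ) = Gal(F′ₙ/K) ⊔ c·Gal(F′ₙ/K)`, memo S5 (b3)).
[cite: Shimura1998, §8.1] [cite: NeukirchANT1999, Ch. IV §1] -/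
theorem fixes_or_conj_mul_fixes (hK2 : Module.finrank ℚ K = 2) {s : K} (hs : s ^ 2 = -7)
    (e : AlgebraicClosure K →+* AlgebraicClosure ℚ) {c : AlgebraicClosure ℚ ≃ₐ[ℚ] AlgebraicClosure ℚ}
    (hc : c (e (algebraMap K (AlgebraicClosure K) s)) = -e (algebraMap K (AlgebraicClosure K) s))
    (σ : AlgebraicClosure ℚ ≃ₐ[ℚ] AlgebraicClosure ℚ) :
    (∀ k : K, σ (e (algebraMap K (AlgebraicClosure K) k)) = e (algebraMap K (AlgebraicClosure K) k)) ∨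
      ∀ k : K, (c * σ) (e (algebraMap K (AlgebraicClosure K) k)) = e (algebraMap K (AlgebraicClosure K) k) := by
  rw [forall_apply_algebraMap_eq_iff hK2 hs e σ, forall_apply_algebraMap_eq_iff hK2 hs e (c * σ), AlgEquiv.mul_apply]
  rcases apply_sqrt_eq_or_eq_neg hs e σ with h | h
  · exact Or.inl h
  · right
    rw [h, map_neg, hc, neg_neg]

/-- A complex conjugation does NOT fix `e(K)` (`c (e s) = −e s ≠ e s`). [cite: Shimura1998, §8.1] -/
theorem not_forall_apply_eq_of_conj {s : K} (hs : s ^ 2 = -7) (e : AlgebraicClosure K →+* AlgebraicClosure ℚ)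
    {c : AlgebraicClosure ℚ ≃ₐ[ℚ] AlgebraicClosure ℚ}
    (hc : c (e (algebraMap K (AlgebraicClosure K) s)) = -e (algebraMap K (AlgebraicClosure K) s)) :
    ¬ ∀ k : K, c (e (algebraMap K (AlgebraicClosure K) k)) = e (algebraMap K (AlgebraicClosure K) k) := by
  intro h
  have h1 := h s
  rw [hc, neg_eq_iff_add_eq_zero, ← two_mul, mul_eq_zero] at h1
  rcases h1 with h1 | h1
  · exact two_ne_zero h1
  · rw [map_eq_zero_iff e e.injective, map_eq_zero_iff _ (algebraMap K (AlgebraicClosure K)).injective] at h1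
    rw [h1] at hs; norm_num at hs

/-- If `σ` does not fix `e(K)` then `c ∘ σ` does, and conversely (the two cosets). [cite: Shimura1998, §8.1] -/
theorem conj_mul_fixes_of_not_fixes (hK2 : Module.finrank ℚ K = 2) {s : K} (hs : s ^ 2 = -7)
    (e : AlgebraicClosure K →+* AlgebraicClosure ℚ) {c : AlgebraicClosure ℚ ≃ₐ[ℚ] AlgebraicClosure ℚ}
    (hc : c (e (algebraMap K (AlgebraicClosure K) s)) = -e (algebraMap K (AlgebraicClosure K) s))
    {σ : AlgebraicClosure ℚ ≃ₐ[ℚ] AlgebraicClosure ℚ}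
    (hσ : ¬ ∀ k : K, σ (e (algebraMap K (AlgebraicClosure K) k)) = e (algebraMap K (AlgebraicClosure K) k)) :
    ∀ k : K, (c * σ) (e (algebraMap K (AlgebraicClosure K) k)) = e (algebraMap K (AlgebraicClosure K) k) :=
  (fixes_or_conj_mul_fixes hK2 hs e hc σ).resolve_left hσ

/-- … and if `σ` fixes `e(K)` then `c ∘ σ` does not. [cite: Shimura1998, §8.1] -/
theorem not_conj_mul_fixes_of_fixes (hK2 : Module.finrank ℚ K = 2) {s : K} (hs : s ^ 2 = -7)
    (e : AlgebraicClosure K →+* AlgebraicClosure ℚ) {c : AlgebraicClosure ℚ ≃ₐ[ℚ] AlgebraicClosure ℚ}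
    (hc : c (e (algebraMap K (AlgebraicClosure K) s)) = -e (algebraMap K (AlgebraicClosure K) s))
    {σ : AlgebraicClosure ℚ ≃ₐ[ℚ] AlgebraicClosure ℚ}
    (hσ : ∀ k : K, σ (e (algebraMap K (AlgebraicClosure K) k)) = e (algebraMap K (AlgebraicClosure K) k)) :
    ¬ ∀ k : K, (c * σ) (e (algebraMap K (AlgebraicClosure K) k)) = e (algebraMap K (AlgebraicClosure K) k) := by
  intro h
  apply not_forall_apply_eq_of_conj hs e hc
  intro k
  have h1 := h k
  rw [AlgEquiv.mul_apply, hσ k] at h1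
  have _ := hK2
  exact h1

end IndexTwo

end Summit.BirchSwinnertonDyer.Rank1Residual.Additive.GenusSeven

end
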